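import Literature.Computability.QuantumComplexity.SolovayKitaev.LieCommutator
import HarnessLib

/-!
# Solovay–Kitaev theorem: balanced group commutators in `SU(n)`

Proof infrastructure for the discharge of
`Literature.Computability.QuantumComplexity.solovay_kitaev`.  This file proves the result of
**Dawson–Nielsen, §5.2** (*The Solovay–Kitaev algorithm*, QIC **6** (2006), p. 9–10, "Balanced
commutators in `SU(d)`", combining their Lemma 2 and Lemma 3): if `Δ ∈ SU(d)` satisfies
`d(I, Δ) < ε` (small), there are `V, W ∈ SU(d)` with `d(I,V), d(I,W) ≤ c √ε` and
`d(VWV†W†, Δ) ≤ c' ε^{3/2}`.  Ingredients: the traceless logarithm `exists_traceless_log` and the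
hand-made exponentials `exists_specialUnitary_near` (file `Diagonal`), Lemma 2
`exists_commutator_eq_smul` (file `LieCommutator`), and — in place of the BCH estimate of their
Lemma 3 — the exact second-order commutator expansion `norm_comm_sub_one_sub_bracket_le`
(file `Basic`).  Constants are explicit but crude: `c = 2|n|²`, `c' = 120|n|⁶`, valid for
`2|n|⁴ ε ≤ 1`.  No definitions and no new statements are introduced; everything is proved.
-/

noncomputable section

open scoped Matrix.Norms.L2Operator ComplexConjugate

namespace Literature.Computability.QuantumComplexity.SolovayKitaev

open Matrix Complex

variable {n : Type*} [Fintype n] [DecidableEq n]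

/-- **Balanced group commutators in `SU(n)`** (Dawson–Nielsen 2006 §5.2: "if `U` satisfies
`d(I,U) < ε` then there exist `V` and `W` satisfying `d(VWV†W†, U) < c_{gc'} ε^{3/2}` and such that
`d(I,V), d(I,W) < c_{gc''} √ε`").  Explicit form: for `Δ ∈ SU(n)` with `‖Δ - 1‖ ≤ δ` and
`2|n|⁴δ ≤ 1` there are `V, W ∈ SU(n)` with `‖V - 1‖, ‖W - 1‖ ≤ 2|n|²√δ` and
`‖VWV⁻¹W⁻¹ - Δ‖ ≤ 120|n|⁶ δ√δ`. [cite: DawsonNielsen2006, §5.2] -/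
theorem exists_balanced_commutator (Δ : Matrix.specialUnitaryGroup n ℂ) {δ : ℝ}
    (hΔ : ‖(Δ : Matrix n n ℂ) - 1‖ ≤ δ) (hδ : 2 * (Fintype.card n : ℝ) ^ 4 * δ ≤ 1) :
    ∃ V W : Matrix.specialUnitaryGroup n ℂ,
      ‖(V : Matrix n n ℂ) - 1‖ ≤ 2 * (Fintype.card n : ℝ) ^ 2 * Real.sqrt δ ∧
      ‖(W : Matrix n n ℂ) - 1‖ ≤ 2 * (Fintype.card n : ℝ) ^ 2 * Real.sqrt δ ∧
      ‖((V * W * V⁻¹ * W⁻¹ : Matrix.specialUnitaryGroup n ℂ) : Matrix n n ℂ) - Δ‖ ≤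
        120 * (Fintype.card n : ℝ) ^ 6 * δ * Real.sqrt δ := by
  have hδ0 : 0 ≤ δ := (norm_nonneg _).trans hΔ
  cases isEmpty_or_nonempty n with
  | inl hn =>
    refine ⟨1, 1, ?_, ?_, ?_⟩
    · rw [Subsingleton.elim (((1 : Matrix.specialUnitaryGroup n ℂ) : Matrix n n ℂ) - 1) 0,
        norm_zero]; positivity
    · rw [Subsingleton.elim (((1 : Matrix.specialUnitaryGroup n ℂ) : Matrix n n ℂ) - 1) 0,
        norm_zero]; positivity
    · rw [Subsingleton.elim (((1 * 1 * 1⁻¹ * 1⁻¹ : Matrix.specialUnitaryGroup n ℂ) :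
        Matrix n n ℂ) - Δ) 0, norm_zero]; positivity
  | inr hn =>
    -- sizes
    set d : ℝ := (Fintype.card n : ℝ) with hd
    have hd1 : (1 : ℝ) ≤ d := by rw [hd]; exact_mod_cast Fintype.card_pos
    have hd2 : (1 : ℝ) ≤ d ^ 2 := one_le_pow₀ hd1
    have hd4 : (1 : ℝ) ≤ d ^ 4 := one_le_pow₀ hd1
    have hd6 : (1 : ℝ) ≤ d ^ 6 := one_le_pow₀ hd1
    have hδ1 : δ ≤ 1 := by
      have : δ ≤ d ^ 4 * δ := le_mul_of_one_le_left hδ0 hd4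
      linarith
    set t : ℝ := Real.sqrt δ with ht
    have ht0 : 0 ≤ t := Real.sqrt_nonneg _
    have htt : t * t = δ := Real.mul_self_sqrt hδ0
    have ht1 : t ≤ 1 := by rw [ht]; exact Real.sqrt_le_one.mpr hδ1
    have hδt : δ ≤ t := by
      calc δ = t * t := htt.symm
        _ ≤ t * 1 := mul_le_mul_of_nonneg_left ht1 ht0
        _ = t := mul_one t
    have hs2 : Real.sqrt (2 * δ) = Real.sqrt 2 * t := by rw [ht, Real.sqrt_mul (by norm_num : (0:ℝ) ≤ 2)]
    have hsqrt2 : Real.sqrt 2 ≤ 3 / 2 := by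
      rw [Real.sqrt_le_left (by norm_num : (0:ℝ) ≤ 3 / 2)]; norm_num
    have hsqrt2' : (0 : ℝ) ≤ Real.sqrt 2 := Real.sqrt_nonneg _
    -- the logarithm
    have h2d : 2 * (Fintype.card n : ℝ) * ‖(Δ : Matrix n n ℂ) - 1‖ ≤ 1 := by
      rw [← hd]
      calc 2 * d * ‖(Δ : Matrix n n ℂ) - 1‖ ≤ 2 * d * δ := by gcongr
        _ ≤ 2 * d ^ 4 * δ := by
            gcongr
            calc d = d ^ 1 := (pow_one d).symm
              _ ≤ d ^ 4 := pow_le_pow_right₀ hd1 (by norm_num)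
        _ ≤ 1 := hδ
    obtain ⟨H, hHh, hHtr, hHn, hHrem⟩ := exists_traceless_log Δ h2d
    have hHδ : ‖H‖ ≤ 2 * δ := hHn.trans (by linarith)
    have hremδ : ‖(Δ : Matrix n n ℂ) - 1 - I • H‖ ≤ 4 * δ ^ 2 :=
      hHrem.trans (by gcongr)
    -- Lemma 2
    obtain ⟨F₂, G₂, hF, hG, hFtr, hGtr, hcomm, hFn, hGn⟩ := exists_commutator_eq_smul H hHh hHtr
    set η : ℝ := d ^ 2 * (Real.sqrt 2 * t) with hη
    have hη0 : 0 ≤ η := by positivity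
    have hsqH : Real.sqrt ‖H‖ ≤ Real.sqrt 2 * t := by rw [← hs2]; exact Real.sqrt_le_sqrt hHδ
    have hFη : ‖F₂‖ ≤ η := hFn.trans (by rw [hη, ← hd]; gcongr)
    have hGη : ‖G₂‖ ≤ η := hGn.trans (by rw [hη, ← hd]; gcongr)
    have hη2 : η ^ 2 ≤ 1 := by
      have : η ^ 2 = d ^ 4 * (2 * δ) := by
        rw [hη, mul_pow, mul_pow, Real.sq_sqrt (by norm_num : (0:ℝ) ≤ 2), ← htt]; ring
      rw [this]; linarith
    have hη1 : η ≤ 1 := (pow_le_one_iff_of_nonneg hη0 two_ne_zero).1 hη2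
    have hηle : η ≤ 2 * d ^ 2 * t := by
      rw [hη]
      calc d ^ 2 * (Real.sqrt 2 * t) ≤ d ^ 2 * (2 * t) := by gcongr; linarith
        _ = 2 * d ^ 2 * t := by ring
    -- the two special unitaries
    obtain ⟨V, hV1, hV2⟩ := exists_specialUnitary_near hG hGtr (hGη.trans hη1)
    obtain ⟨W, hW1, hW2⟩ := exists_specialUnitary_near hF hFtr (hFη.trans hη1)
    refine ⟨V, W, (hV1.trans hGη).trans (by rw [hd] at hηle; exact hηle),
      (hW1.trans hFη).trans (by rw [hd] at hηle; exact hηle), ?_⟩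
    -- the skew-Hermitian first-order terms
    set b : Matrix n n ℂ := I • G₂ with hb
    set c : Matrix n n ℂ := I • F₂ with hc
    have hbn : ‖b‖ ≤ η := by rw [hb, norm_smul, Complex.norm_I, one_mul]; exact hGη
    have hcn : ‖c‖ ≤ η := by rw [hc, norm_smul, Complex.norm_I, one_mul]; exact hFη
    have hVb : ‖(V : Matrix n n ℂ) - 1 - b‖ ≤ η ^ 2 :=
      hV2.trans (pow_le_pow_left₀ (norm_nonneg _) hGη 2)
    have hWc : ‖(W : Matrix n n ℂ) - 1 - c‖ ≤ η ^ 2 :=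
      hW2.trans (pow_le_pow_left₀ (norm_nonneg _) hFη 2)
    have hbc : b * c - c * b = I • H := by
      rw [← hcomm, hb, hc, Matrix.smul_mul, Matrix.mul_smul, smul_smul, Matrix.smul_mul,
        Matrix.mul_smul, smul_smul, I_mul_I, neg_one_smul, neg_one_smul]
      abel
    have key := norm_comm_sub_one_sub_bracket_le V.2.1 W.2.1 b c hbn hcn hVb hWc
    have hcoe : ((V * W * V⁻¹ * W⁻¹ : Matrix.specialUnitaryGroup n ℂ) : Matrix n n ℂ) =
        (V : Matrix n n ℂ) * W * star (V : Matrix n n ℂ) * star (W : Matrix n n ℂ) := by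
      simp only [Submonoid.coe_mul, coe_inv]
    rw [hcoe]
    -- polynomial bookkeeping: everything is `O(δ t)` with `A = d⁶ δ t`
    set A : ℝ := d ^ 6 * δ * t with hA
    have hA0 : 0 ≤ A := by positivity
    have hη3 : η ^ 3 ≤ 3 * A := by
      have h1 : η ^ 3 = (Real.sqrt 2) ^ 3 * (d ^ 6 * (t * t) * t) := by rw [hη]; ring
      have h2 : (Real.sqrt 2) ^ 3 ≤ 3 := by
        have h22 : (Real.sqrt 2) ^ 2 = 2 := Real.sq_sqrt (by norm_num)
        calc (Real.sqrt 2) ^ 3 = (Real.sqrt 2) ^ 2 * Real.sqrt 2 := pow_succ _ 2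
          _ = 2 * Real.sqrt 2 := by rw [h22]
          _ ≤ 2 * (3 / 2) := by gcongr
          _ = 3 := by norm_num
      have hA0' : 0 ≤ d ^ 6 * (t * t) * t := by positivity
      rw [h1, hA, ← htt]
      exact mul_le_mul_of_nonneg_right h2 hA0'
    have hδ2 : δ ^ 2 ≤ A := by
      rw [hA, sq]
      calc δ * δ ≤ δ * t := by gcongr
        _ = 1 * δ * t := by ring
        _ ≤ d ^ 6 * δ * t := by gcongr
    have hpoly : 4 * (η + η ^ 2) ^ 3 + 4 * η * η ^ 2 + 2 * (η ^ 2) ^ 2 ≤ 38 * η ^ 3 := by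
      have hη2' : η ^ 2 ≤ η := by
        calc η ^ 2 = η * η := sq η
          _ ≤ η * 1 := mul_le_mul_of_nonneg_left hη1 hη0
          _ = η := mul_one η
      have h1 : (η + η ^ 2) ^ 3 ≤ 8 * η ^ 3 := by
        calc (η + η ^ 2) ^ 3 ≤ (2 * η) ^ 3 := pow_le_pow_left₀ (by positivity) (by linarith) 3
          _ = 8 * η ^ 3 := by ring
      have h2 : (η ^ 2) ^ 2 ≤ η ^ 3 := by
        calc (η ^ 2) ^ 2 = η ^ 3 * η := by ring
          _ ≤ η ^ 3 * 1 := mul_le_mul_of_nonneg_left hη1 (by positivity)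
          _ = η ^ 3 := mul_one _
      have h3 : 4 * η * η ^ 2 = 4 * η ^ 3 := by ring
      rw [h3]
      linarith
    calc ‖(V : Matrix n n ℂ) * W * star (V : Matrix n n ℂ) * star (W : Matrix n n ℂ) - Δ‖
        = ‖((V : Matrix n n ℂ) * W * star (V : Matrix n n ℂ) * star (W : Matrix n n ℂ) - 1 -
            (b * c - c * b)) - ((Δ : Matrix n n ℂ) - 1 - I • H)‖ := by
          rw [hbc]; congr 1; abel
      _ ≤ ‖(V : Matrix n n ℂ) * W * star (V : Matrix n n ℂ) * star (W : Matrix n n ℂ) - 1 -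
            (b * c - c * b)‖ + ‖(Δ : Matrix n n ℂ) - 1 - I • H‖ := norm_sub_le _ _
      _ ≤ (4 * (η + η ^ 2) ^ 3 + 4 * η * η ^ 2 + 2 * (η ^ 2) ^ 2) + 4 * δ ^ 2 :=
          add_le_add key hremδ
      _ ≤ 38 * η ^ 3 + 4 * δ ^ 2 := by linarith
      _ ≤ 38 * (3 * A) + 4 * A := by linarith
      _ ≤ 120 * A := by linarith
      _ = 120 * (Fintype.card n : ℝ) ^ 6 * δ * Real.sqrt δ := by rw [hA, hd, ht]; ring

end Literature.Computability.QuantumComplexity.SolovayKitaev
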